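import Mathlib.Topology.OpenPartialHomeomorph.Constructions
import Mathlib.Topology.Algebra.Group.Basic
import Mathlib.Geometry.Manifold.ChartedSpace
import HarnessLib

/-!
# Microbundle germs in graph form, I: fibrewise partial homeomorphisms, slices, local charts

Topic `Literature/Topology/Immersions` (topological immersion theory; Milnor's microbundles).

Milnor (*Microbundles, Part I*, Topology **3** Suppl. 1 (1964) 53–80, §2) defines the **tangent
microbundle** `t_V` of a topological manifold `V` as the diagram `V —Δ→ V × V —pr₁→ V`, and, for a
continuous `g : B → V`, the **induced microbundle** `g^* t_V` as `B —(id, g)→ B × V —pr₁→ B`; a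
microbundle is **trivial** if a neighbourhood of its zero section is homeomorphic, fibrewise and
respecting the zero section, to a neighbourhood of `B × 0` in `B × ℝⁿ` (§2, p. 56).  This file and
its sequels (`MicrobundleGermGluing`, `MicrobundleGermPatching`, `TangentMicrobundleContractible`)
formalise exactly as much of §§2–3 of Milnor's paper as is needed for

> **Milnor 1964, §3, Homotopy Theorem and its Corollary**: microbundles induced by homotopic maps
> from a paracompact base are isomorphic; hence every microbundle over a paracompact contractible
> base is trivial — in particular the tangent microbundle of a contractible (paracompact)
> topological manifold is trivial,

the sentence "*if the manifold in question is contractible there can be no obstruction to the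
lifting*" of Freedman's proof of Cor. 1.2 (J. Differential Geom. 17 (1982), p. 366) and the
hypothesis of Lees' topological immersion theorem in the form used by immersion-theoretic
smoothing (Lashof 1971, Ch. 2; Kirby–Siebenmann 1977, Essay V §1).

**Graph form, no new definitions.**  All microbundles met here are induced from a tangent
microbundle, so their total space is literally `B × V` with zero section the graph of `g`; a
trivialisation (resp. an isomorphism germ) is therefore an `OpenPartialHomeomorph (B × V) (B × E)`
(resp. `(B × V) (B × V)`) which is **fibrewise** — `(Φ p).1 = p.1` on `Φ.source` — whose source
contains the graph and which sends `(b, g b)` to `(b, 0)` (resp. to `(b, g' b)`).  Every statement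
below is spelled out in these terms with Mathlib's `OpenPartialHomeomorph`; nothing is defined.

## Contents (all proved)

* bookkeeping for fibrewise partial homeomorphisms: `symm`, `trans`, `restrOpen`, images of
  "vertical" sets (`fst_symm_eq`, `fst_trans_eq`, `isImage_fst_preimage`);
* `exists_fibrewise_shear` — the fibrewise translation `(b, x) ↦ (b, x - c b)` over an open set on
  which `c` is continuous;
* `exists_fibrewise_normalise` — re-normalising a fibrewise chart so that the graph of `g` goes to
  the zero section (Milnor §2, proof of Lemma 2.3: "composing with a translation in each fibre");
* `exists_local_trivialisation_comp` — **Milnor 1964, Lemma 2.1 / Example (2) p. 55–56 in graph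
  form**: the microbundle induced from `t_V` by a continuous `s : B → V` is locally trivial: near
  each `q₀` one fibrewise chart, normalised along the graph, is `(q, y) ↦ (q, ψ y - ψ (s q))` for a
  chart `ψ` of `V` at `s q₀`;
* `exists_slice` — restriction of a fibrewise partial homeomorphism over `B × T` to the graph of a
  continuous `μ : B → T` ("the induced microbundle along the section `b ↦ (b, μ b)`");
* `exists_spread` — the `T`-independent extension of a fibrewise partial homeomorphism over `B` to
  one over `B × T` (Milnor §3, proof of Lemma 3.1: "extend `g` over `B × [½,1]` by `g(b,t,x) =
  g(b,½,x)`").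

## References

* J. Milnor, *Microbundles, Part I*, Topology 3, Suppl. 1 (1964) 53–80, §2 (Lemma 2.1, Lemma 2.3),
  §3 (Lemma 3.1, Homotopy Theorem). [Milnor1964]
* R. Lashof, *The immersion approach to triangulation and smoothing*, Proc. Sympos. Pure Math.
  XXII (1971) 131–164, Ch. 2. [Lashof1971]
* R. C. Kirby, L. C. Siebenmann, *Foundational essays*, Ann. of Math. Stud. 88 (1977), Essay IV
  §1 and Essay V §1. [KirbySiebenmann1977]
-/

open Set Function Filter Topology

namespace Literature.Topology.Immersions

universe u v w

variable {B : Type u} [TopologicalSpace B] {F : Type v} [TopologicalSpace F]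
  {F' : Type w} [TopologicalSpace F'] {F'' : Type*} [TopologicalSpace F'']

/-! ### Fibrewise partial homeomorphisms: bookkeeping -/

/-- The inverse of a fibrewise partial homeomorphism is fibrewise (on its source, the target of
the original). [folklore] -/
theorem fst_symm_eq (Φ : OpenPartialHomeomorph (B × F) (B × F'))
    (hΦ : ∀ p ∈ Φ.source, (Φ p).1 = p.1) {q : B × F'} (hq : q ∈ Φ.target) :
    (Φ.symm q).1 = q.1 := by
  have h := hΦ (Φ.symm q) (Φ.map_target hq)
  rw [Φ.right_inv hq] at h
  exact h.symm

/-- The composite of fibrewise partial homeomorphisms is fibrewise. [folklore] -/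
theorem fst_trans_eq (Φ : OpenPartialHomeomorph (B × F) (B × F'))
    (Ψ : OpenPartialHomeomorph (B × F') (B × F''))
    (hΦ : ∀ p ∈ Φ.source, (Φ p).1 = p.1) (hΨ : ∀ p ∈ Ψ.source, (Ψ p).1 = p.1) :
    ∀ p ∈ (Φ.trans Ψ).source, ((Φ.trans Ψ) p).1 = p.1 := by
  intro p hp
  rw [OpenPartialHomeomorph.trans_source] at hp
  rw [OpenPartialHomeomorph.trans_apply, hΨ _ hp.2, hΦ _ hp.1]

/-- A restriction of a fibrewise partial homeomorphism is fibrewise. [folklore] -/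
theorem fst_restrOpen_eq (Φ : OpenPartialHomeomorph (B × F) (B × F'))
    (hΦ : ∀ p ∈ Φ.source, (Φ p).1 = p.1) (O : Set (B × F)) (hO : IsOpen O) :
    ∀ p ∈ (Φ.restrOpen O hO).source, ((Φ.restrOpen O hO) p).1 = p.1 := by
  intro p hp
  rw [OpenPartialHomeomorph.restrOpen_source] at hp
  exact hΦ p hp.1

/-- A fibrewise partial homeomorphism maps the part of its source over `A ⊆ B` onto the part of
its target over `A` (`OpenPartialHomeomorph.IsImage`). [folklore] -/
theorem isImage_fst_preimage (Φ : OpenPartialHomeomorph (B × F) (B × F'))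
    (hΦ : ∀ p ∈ Φ.source, (Φ p).1 = p.1) (A : Set B) :
    Φ.IsImage (Prod.fst ⁻¹' A) (Prod.fst ⁻¹' A) := by
  intro p hp
  simp only [mem_preimage, hΦ p hp]

/-- The target of a fibrewise partial homeomorphism lies over the projection of its source: if
`q ∈ Φ.target` then `(q.1, (Φ.symm q).2) ∈ Φ.source` and `Φ (q.1, (Φ.symm q).2) = q`. [folklore] -/
theorem symm_eq_of_fibrewise (Φ : OpenPartialHomeomorph (B × F) (B × F'))
    (hΦ : ∀ p ∈ Φ.source, (Φ p).1 = p.1) {q : B × F'} (hq : q ∈ Φ.target) :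
    Φ.symm q = (q.1, (Φ.symm q).2) :=
  Prod.ext (fst_symm_eq Φ hΦ hq) rfl

/-- Pointwise form of "fibrewise": `Φ p = (p.1, (Φ p).2)` on the source. [folklore] -/
theorem eq_of_fibrewise (Φ : OpenPartialHomeomorph (B × F) (B × F'))
    (hΦ : ∀ p ∈ Φ.source, (Φ p).1 = p.1) {p : B × F} (hp : p ∈ Φ.source) :
    Φ p = (p.1, (Φ p).2) :=
  Prod.ext (hΦ p hp) rfl

/-! ### Fibrewise translations and normalisation along a graph -/

section Shear

variable {E : Type w} [TopologicalSpace E] [AddGroup E] [IsTopologicalAddGroup E]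

/-- **Fibrewise translation.**  For `c : B → E` continuous on an open `O ⊆ B` there is a fibrewise
partial homeomorphism of `B × E` with source and target `O × E` acting by `(b, x) ↦ (b, x - c b)`,
with inverse `(b, x) ↦ (b, x + c b)` (Milnor 1964, §2, the translations used to normalise local
trivialisations). [folklore] -/
theorem exists_fibrewise_shear {O : Set B} (hO : IsOpen O) {c : B → E} (hc : ContinuousOn c O) :
    ∃ σ : OpenPartialHomeomorph (B × E) (B × E),
      σ.source = O ×ˢ univ ∧ σ.target = O ×ˢ univ ∧
      (∀ p, σ p = (p.1, p.2 - c p.1)) ∧ (∀ q, σ.symm q = (q.1, q.2 + c q.1)) := by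
  refine ⟨{ toFun := fun p => (p.1, p.2 - c p.1)
            invFun := fun q => (q.1, q.2 + c q.1)
            source := O ×ˢ univ
            target := O ×ˢ univ
            map_source' := fun p hp => ⟨hp.1, mem_univ _⟩
            map_target' := fun q hq => ⟨hq.1, mem_univ _⟩
            left_inv' := fun p _ => by simp
            right_inv' := fun q _ => by simp
            open_source := hO.prod isOpen_univ
            open_target := hO.prod isOpen_univ
            continuousOn_toFun := ?_
            continuousOn_invFun := ?_ }, rfl, rfl, fun _ => rfl, fun _ => rfl⟩
  · exact continuousOn_fst.prodMk
      (continuousOn_snd.sub (hc.comp continuousOn_fst fun p hp => hp.1))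
  · exact continuousOn_fst.prodMk
      (continuousOn_snd.add (hc.comp continuousOn_fst fun p hp => hp.1))

/-- **Normalisation along a graph** (Milnor 1964, §2: a local trivialisation may be assumed to send
the zero section to the zero section, after a translation in each fibre).  Given a fibrewise
partial homeomorphism `Ψ : B × V ⇀ B × E` and a continuous `g : B → V`, there is a fibrewise
`Φ : B × V ⇀ B × E` whose source is the part of `Ψ.source` over the open set
`O = {b | (b, g b) ∈ Ψ.source}`, given by `Φ p = ((Ψ p).1, (Ψ p).2 - (Ψ ((Ψ p).1, g (Ψ p).1)).2)`
(`= (p.1, (Ψ p).2 - (Ψ (p.1, g p.1)).2)` on the source), so that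
`Φ (b, g b) = (b, 0)` for every `b ∈ O`. [folklore] -/
theorem exists_fibrewise_normalise (Ψ : OpenPartialHomeomorph (B × F) (B × E))
    (hΨ : ∀ p ∈ Ψ.source, (Ψ p).1 = p.1) {g : B → F} (hg : Continuous g) :
    ∃ Φ : OpenPartialHomeomorph (B × F) (B × E),
      (∀ p ∈ Φ.source, (Φ p).1 = p.1) ∧
      Φ.source = Ψ.source ∩ Prod.fst ⁻¹' {b | (b, g b) ∈ Ψ.source} ∧
      (∀ p, Φ p = ((Ψ p).1, (Ψ p).2 - (Ψ ((Ψ p).1, g (Ψ p).1)).2)) ∧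
      (∀ q, Φ.symm q = Ψ.symm (q.1, q.2 + (Ψ (q.1, g q.1)).2)) ∧
      (∀ b, (b, g b) ∈ Ψ.source → (b, g b) ∈ Φ.source ∧ Φ (b, g b) = (b, 0)) := by
  set O : Set B := {b | (b, g b) ∈ Ψ.source} with hO_def
  have hO : IsOpen O := Ψ.open_source.preimage (continuous_id.prodMk hg)
  have hc : ContinuousOn (fun b => (Ψ (b, g b)).2) O :=
    continuousOn_snd.comp (Ψ.continuousOn.comp (continuous_id.prodMk hg).continuousOn
      fun b hb => hb) (mapsTo_univ _ _)
  obtain ⟨σ, hσs, hσt, hσ, hσ'⟩ := exists_fibrewise_shear (E := E) hO hc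
  have hOV : IsOpen ((Prod.fst ⁻¹' O) : Set (B × F)) := hO.preimage continuous_fst
  refine ⟨(Ψ.restrOpen (Prod.fst ⁻¹' O) hOV).trans σ, ?_, ?_, ?_, ?_, ?_⟩
  · refine fst_trans_eq _ _ (fst_restrOpen_eq Ψ hΨ _ hOV) ?_
    intro p _
    rw [hσ]
  · ext p
    simp only [OpenPartialHomeomorph.trans_source, OpenPartialHomeomorph.restrOpen_source,
      OpenPartialHomeomorph.coe_restrOpen, hσs, mem_inter_iff, mem_preimage, mem_prod, mem_univ,
      and_true]
    constructor
    · rintro ⟨⟨hp, hO'⟩, -⟩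
      exact ⟨hp, hO'⟩
    · rintro ⟨hp, hO'⟩
      exact ⟨⟨hp, hO'⟩, by rw [hΨ p hp]; exact hO'⟩
  · intro p
    rw [OpenPartialHomeomorph.trans_apply, OpenPartialHomeomorph.coe_restrOpen, hσ]
  · intro q
    rw [OpenPartialHomeomorph.trans_symm_eq_symm_trans_symm, OpenPartialHomeomorph.trans_apply,
      hσ', OpenPartialHomeomorph.coe_restrOpen_symm]
  · intro b hb
    have hbO : b ∈ O := hb
    refine ⟨?_, ?_⟩
    · rw [OpenPartialHomeomorph.trans_source, OpenPartialHomeomorph.restrOpen_source, hσs]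
      refine ⟨⟨hb, hbO⟩, ?_⟩
      simp only [mem_preimage, OpenPartialHomeomorph.coe_restrOpen, mem_prod, mem_univ, and_true]
      rw [hΨ _ hb]
      exact hbO
    · rw [OpenPartialHomeomorph.trans_apply, OpenPartialHomeomorph.coe_restrOpen, hσ, hΨ _ hb,
        sub_self]

end Shear

/-! ### Local triviality of the microbundle induced from a tangent microbundle -/

section LocalChart

variable {E : Type w} [TopologicalSpace E] [AddGroup E] [IsTopologicalAddGroup E]
  {V : Type v} [TopologicalSpace V] [ChartedSpace E V]

/-- **Milnor 1964, §2 (Example 2, p. 55 and Lemma 2.1): the tangent microbundle of a topological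
manifold, and every microbundle induced from it, is locally trivial — graph form.**  Let `V` be
charted on the topological group `E` (e.g. `ℝⁿ`) and `s : B → V` continuous.  For every `q₀ : B`
there are an open `N ∋ q₀` and a fibrewise partial homeomorphism `Φ : B × V ⇀ B × E` whose source
contains the graph of `s` over `N` and which is normalised along it, `Φ (q, s q) = (q, 0)`:
namely `Φ (q, y) = (q, ψ y - ψ (s q))` with `ψ` the chart of `V` at `s q₀` and
`N = s ⁻¹' ψ.source` (Milnor: "the homeomorphism `(u, v) ↦ (u, h(v) - h(u))`").
[cite: Milnor1964, §2, Lemma 2.1 and Example (2)] -/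
theorem exists_local_trivialisation_comp {s : B → V} (hs : Continuous s) (q₀ : B) :
    ∃ N : Set B, IsOpen N ∧ q₀ ∈ N ∧ ∃ Φ : OpenPartialHomeomorph (B × V) (B × E),
      (∀ p ∈ Φ.source, (Φ p).1 = p.1) ∧
      Φ.source = (N ×ˢ (chartAt E (s q₀)).source) ∧
      (∀ p, Φ p = (p.1, chartAt E (s q₀) p.2 - chartAt E (s q₀) (s p.1))) ∧
      (∀ q ∈ N, (q, s q) ∈ Φ.source ∧ Φ (q, s q) = (q, 0)) := by
  set ψ := chartAt E (s q₀) with hψ_def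
  set Ψ : OpenPartialHomeomorph (B × V) (B × E) := (OpenPartialHomeomorph.refl B).prod ψ
    with hΨ_def
  have hΨ : ∀ p ∈ Ψ.source, (Ψ p).1 = p.1 := fun p _ => rfl
  obtain ⟨Φ, hΦ, hsrc, happ, -, hgraph⟩ := exists_fibrewise_normalise Ψ hΨ hs
  refine ⟨s ⁻¹' ψ.source, ψ.open_source.preimage hs, mem_chart_source E (s q₀), Φ, hΦ, ?_, ?_, ?_⟩
  · rw [hsrc]
    ext p
    simp [hΨ_def, and_comm]
  · intro p
    rw [happ]
    rfl
  · intro q hq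
    exact hgraph q (by simp [hΨ_def, mem_preimage.mp hq])

end LocalChart

/-! ### Slicing along a section and spreading over a parameter -/

section Slice

variable {T : Type*} [TopologicalSpace T]

/-- **Slice along a continuous section.**  Let `Φ : (B × T) × F ⇀ (B × T) × F'` be fibrewise over
`B × T` and `μ : B → T` continuous.  Restricting `Φ` to the graph of `μ` gives a fibrewise
partial homeomorphism `Φμ : B × F ⇀ B × F'` over `B`, `Φμ (b, y) = (b, (Φ ((b, μ b), y)).2)`,
with source `{(b, y) | ((b, μ b), y) ∈ Φ.source}` and inverse
`(b, x) ↦ (b, (Φ.symm ((b, μ b), x)).2)` — the microbundle induced along the section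
`b ↦ (b, μ b)` (Milnor 1964, §3, the restrictions `𝔢 | B × t`). [cite: Milnor1964, §3] -/
theorem exists_slice (Φ : OpenPartialHomeomorph ((B × T) × F) ((B × T) × F'))
    (hΦ : ∀ p ∈ Φ.source, (Φ p).1 = p.1) {μ : B → T} (hμ : Continuous μ) :
    ∃ Φμ : OpenPartialHomeomorph (B × F) (B × F'),
      (∀ p ∈ Φμ.source, (Φμ p).1 = p.1) ∧
      Φμ.source = {p | ((p.1, μ p.1), p.2) ∈ Φ.source} ∧
      Φμ.target = {q | ((q.1, μ q.1), q.2) ∈ Φ.target} ∧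
      (∀ p, Φμ p = (p.1, (Φ ((p.1, μ p.1), p.2)).2)) ∧
      (∀ q, Φμ.symm q = (q.1, (Φ.symm ((q.1, μ q.1), q.2)).2)) := by
  -- the embedding of `B × F` into `(B × T) × F` along the graph of `μ`
  have hι : Continuous fun p : B × F => ((p.1, μ p.1), p.2) :=
    (continuous_fst.prodMk (hμ.comp continuous_fst)).prodMk continuous_snd
  have hι' : Continuous fun q : B × F' => ((q.1, μ q.1), q.2) :=
    (continuous_fst.prodMk (hμ.comp continuous_fst)).prodMk continuous_snd
  have key : ∀ p : B × F, ((p.1, μ p.1), p.2) ∈ Φ.source →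
      Φ ((p.1, μ p.1), p.2) = ((p.1, μ p.1), (Φ ((p.1, μ p.1), p.2)).2) :=
    fun p hp => eq_of_fibrewise Φ hΦ hp
  have key' : ∀ q : B × F', ((q.1, μ q.1), q.2) ∈ Φ.target →
      Φ.symm ((q.1, μ q.1), q.2) = ((q.1, μ q.1), (Φ.symm ((q.1, μ q.1), q.2)).2) :=
    fun q hq => symm_eq_of_fibrewise Φ hΦ hq
  refine ⟨{ toFun := fun p => (p.1, (Φ ((p.1, μ p.1), p.2)).2)
            invFun := fun q => (q.1, (Φ.symm ((q.1, μ q.1), q.2)).2)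
            source := {p | ((p.1, μ p.1), p.2) ∈ Φ.source}
            target := {q | ((q.1, μ q.1), q.2) ∈ Φ.target}
            map_source' := ?_
            map_target' := ?_
            left_inv' := ?_
            right_inv' := ?_
            open_source := Φ.open_source.preimage hι
            open_target := Φ.open_target.preimage hι'
            continuousOn_toFun := ?_
            continuousOn_invFun := ?_ }, fun _ _ => rfl, rfl, rfl, fun _ => rfl, fun _ => rfl⟩
  · intro p hp
    change ((p.1, μ p.1), (Φ ((p.1, μ p.1), p.2)).2) ∈ Φ.target
    rw [← key p hp]
    exact Φ.map_source hp
  · intro q hq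
    change ((q.1, μ q.1), (Φ.symm ((q.1, μ q.1), q.2)).2) ∈ Φ.source
    rw [← key' q hq]
    exact Φ.map_target hq
  · intro p hp
    change (p.1, (Φ.symm ((p.1, μ p.1), (Φ ((p.1, μ p.1), p.2)).2)).2) = p
    rw [← key p hp, Φ.left_inv hp]
  · intro q hq
    change (q.1, (Φ ((q.1, μ q.1), (Φ.symm ((q.1, μ q.1), q.2)).2)).2) = q
    rw [← key' q hq, Φ.right_inv hq]
  · exact continuousOn_fst.prodMk
      (continuousOn_snd.comp (Φ.continuousOn.comp hι.continuousOn fun p hp => hp)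
        (mapsTo_univ _ _))
  · exact continuousOn_fst.prodMk
      (continuousOn_snd.comp (Φ.continuousOn_symm.comp hι'.continuousOn fun q hq => hq)
        (mapsTo_univ _ _))

/-- **Spreading over a parameter.**  A fibrewise partial homeomorphism `g : B × F ⇀ B × F'` over
`B` extends `T`-independently to a fibrewise partial homeomorphism over `B × T`,
`G ((b, t), y) = ((b, t), (g (b, y)).2)`, with source `{((b, t), y) | (b, y) ∈ g.source}` (Milnor
1964, §3, proof of Lemma 3.1: the germ over `B × ½` is extended over `B × [½, 1]` constantly in
`t`). [cite: Milnor1964, §3, proof of Lemma 3.1] -/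
theorem exists_spread (g : OpenPartialHomeomorph (B × F) (B × F'))
    (hg : ∀ p ∈ g.source, (g p).1 = p.1) (T : Type*) [TopologicalSpace T] :
    ∃ G : OpenPartialHomeomorph ((B × T) × F) ((B × T) × F'),
      (∀ p ∈ G.source, (G p).1 = p.1) ∧
      G.source = {p | (p.1.1, p.2) ∈ g.source} ∧
      G.target = {q | (q.1.1, q.2) ∈ g.target} ∧
      (∀ p, G p = (p.1, (g (p.1.1, p.2)).2)) ∧
      (∀ q, G.symm q = (q.1, (g.symm (q.1.1, q.2)).2)) := by
  have hπ : Continuous fun p : (B × T) × F => (p.1.1, p.2) :=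
    (continuous_fst.comp continuous_fst).prodMk continuous_snd
  have hπ' : Continuous fun q : (B × T) × F' => (q.1.1, q.2) :=
    (continuous_fst.comp continuous_fst).prodMk continuous_snd
  refine ⟨{ toFun := fun p => (p.1, (g (p.1.1, p.2)).2)
            invFun := fun q => (q.1, (g.symm (q.1.1, q.2)).2)
            source := {p | (p.1.1, p.2) ∈ g.source}
            target := {q | (q.1.1, q.2) ∈ g.target}
            map_source' := ?_
            map_target' := ?_
            left_inv' := ?_
            right_inv' := ?_
            open_source := g.open_source.preimage hπ
            open_target := g.open_target.preimage hπ'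
            continuousOn_toFun := ?_
            continuousOn_invFun := ?_ }, fun _ _ => rfl, rfl, rfl, fun _ => rfl, fun _ => rfl⟩
  · intro p hp
    change (p.1.1, (g (p.1.1, p.2)).2) ∈ g.target
    rw [← eq_of_fibrewise g hg hp]
    exact g.map_source hp
  · intro q hq
    change (q.1.1, (g.symm (q.1.1, q.2)).2) ∈ g.source
    rw [← symm_eq_of_fibrewise g hg hq]
    exact g.map_target hq
  · intro p hp
    change (p.1, (g.symm (p.1.1, (g (p.1.1, p.2)).2)).2) = p
    rw [← eq_of_fibrewise g hg hp, g.left_inv hp]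
  · intro q hq
    change (q.1, (g (q.1.1, (g.symm (q.1.1, q.2)).2)).2) = q
    rw [← symm_eq_of_fibrewise g hg hq, g.right_inv hq]
  · exact continuousOn_fst.prodMk
      (continuousOn_snd.comp (g.continuousOn.comp hπ.continuousOn fun p hp => hp)
        (mapsTo_univ _ _))
  · exact continuousOn_fst.prodMk
      (continuousOn_snd.comp (g.continuousOn_symm.comp hπ'.continuousOn fun q hq => hq)
        (mapsTo_univ _ _))

end Slice

end Literature.Topology.Immersions
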